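import Summits.NavierStokesRegularity.FluidComputer.PalasekTowerStrainH2ShadowedRun
import Literature.Analysis.FluidPDE.NSRobustnessOfRegularitySmoothingSupNorm

/-!
# THE STRAIN-SHADOWED RUN, HYBRID CURRENCY (route (A′)) — I: a-priori `δ`-closeness, `H²` by smoothing on windows `τw`

Cell `ns-blowup`, seat `ns-blowup-fc-prover-2` (g10); LEAD `ns-palasek-20303-p1`'s ASK (iv), on the template of the route-(B)
door `StrainShadowH2.freeRun_near_of_strainH2` (p536175). LABEL: E–C typing + kernel analysis (theorems only; no definition, no
named fact, no `sorry`). WHAT THIS IS NOT: not Navier–Stokes evidence — closeness of a GIVEN free run to a GIVEN forced reference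
on a FIXED slab under explicit real inequalities; nothing is exhibited. Route (B) pays the `H²` fee `e^{Λ₂}` over the whole slab;
here the `H¹` letter runs on `[0, s]` and the `H²` level only on windows of length `τw`: for `t ≤ τw` the `H²`-datum door
(`classicalNS_norm_sub_le_strain_window_half_R3`) on `[0, min(s, τw)]`, for `t ≥ τw` the SMOOTHING brick
`classicalNS_norm_sub_le_H2_smoothing_subwindow_half_R3` on `[t − τw, t]`, fed by the DISSIPATION BUDGET
`Dτ(t) ≥ X₁(t − τw) + ∫_{t−τw}^{t} φ` of the `H¹` balance (no `H²` defect). Existence half: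
`PalasekTowerStrainHybridShadowedRunExists.lean`; consumer `StrainDoor.episodeBaseGAt_of_mechanismDoorAt_of_nearFreeRun` (p530553).
References: [cite: RobinsonRodrigoSadowskiCUP2016, Thm 9.1 and Thm 1.20]; [cite: DashtiRobinson2008, Thm 1, Thm 2];
[cite: ConstantinFoias1988, Ch. 10]; [cite: Tao2011, Thm. 5.4 (ii)+(iv)]; [cite: Palasek2026ElementaryModel, §4].
-/

noncomputable section

namespace Summit.NavierStokesRegularity.FluidComputer.PalasekTowerClayBridge.StrainShadowHybrid

open Set MeasureTheory Filter Topology Function InnerProductSpace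
open scoped ENNReal NNReal ContDiff RealInnerProductSpace
open Literature.Analysis Literature.Analysis.FluidPDE


/-- A smooth compactly supported field on `ℝ³` is rapidly decaying (Fefferman's (4)).
[cite: FeffermanClay2006, (4)] -/
private theorem hasRapidSpatialDecay_of_hasCompactSupport
    {φ : EuclideanSpace ℝ (Fin 3) → EuclideanSpace ℝ (Fin 3)} (hsm : ContDiff ℝ ∞ φ)
    (hc : HasCompactSupport φ) : HasRapidSpatialDecay φ := by
  intro n K
  have hcont : Continuous fun x => (1 + ‖x‖) ^ K * ‖iteratedFDeriv ℝ n φ x‖ :=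
    ((continuous_const.add continuous_norm).pow K).mul
      (hsm.continuous_iteratedFDeriv (m := n) (mod_cast le_top)).norm
  have hsupp : HasCompactSupport fun x => (1 + ‖x‖) ^ K * ‖iteratedFDeriv ℝ n φ x‖ :=
    ((hc.iteratedFDeriv n).norm).mul_left
  obtain ⟨C, hC⟩ := hcont.bounded_above_of_compact_support hsupp
  exact ⟨C, fun x => by have h := hC x; rwa [Real.norm_eq_abs, abs_of_nonneg (by positivity)] at h⟩

/-- From `∫⁻ ‖f‖ₑ² ≤ C` to `eLpNorm f 2 ≤ √C`. (Plumbing.) [folklore] -/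
private theorem eLpNorm_le_sqrt_of_lintegral_sq_le {G : Type*} [NormedAddCommGroup G]
    {f : EuclideanSpace ℝ (Fin 3) → G} {C : ℝ≥0} (h : ∫⁻ x, ‖f x‖ₑ ^ 2 ≤ C) :
    eLpNorm f 2 volume ≤ (NNReal.sqrt C : ℝ≥0∞) := by
  rw [lintegral_enorm_sq_eq_eLpNorm_two_sq] at h
  have h2 : eLpNorm f 2 volume = (eLpNorm f 2 volume ^ 2) ^ (1 / 2 : ℝ) := by
    rw [← ENNReal.rpow_natCast, ← ENNReal.rpow_mul]; norm_num
  rw [h2]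
  calc (eLpNorm f 2 volume ^ 2) ^ (1 / 2 : ℝ) ≤ (C : ℝ≥0∞) ^ (1 / 2 : ℝ) := ENNReal.rpow_le_rpow h (by norm_num)
    _ = (NNReal.sqrt C : ℝ≥0∞) := by
        rw [NNReal.sqrt_eq_rpow, ENNReal.coe_rpow_of_nonneg _ (by norm_num)]

section Main

variable {T Bw E₀ κ μ D₁ Ψ₁ D₂ Ψ₂ δ τw : ℝ}
  {w r : ℝ → EuclideanSpace ℝ (Fin 3) → EuclideanSpace ℝ (Fin 3)}
  {ϖ : ℝ → EuclideanSpace ℝ (Fin 3) → ℝ} {G σ₂ σ₃ Rr L H₁ ψ₁ ψ₂ X₁ Dτ Ψτ : ℝ → ℝ}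
  {U : EuclideanSpace ℝ (Fin 3) → EuclideanSpace ℝ (Fin 3)}

set_option maxHeartbeats 400000 in
/-- **A-PRIORI HALF (hybrid currency): every free run from `U` on a sub-slab `[0, s] ⊆ [0, T]` stays `δ`-close to the
reference** — `L²` stage `l2_stability_strain_forced`, `H¹` letter `classicalNS_robustness_strain_window_of_le_R3` on `[0, s]`,
then for `t ≤ τw` the `H²`-datum door on `[0, min(s, τw)]` (EARLY inputs `D₂, Ψ₂`, half-smallness, `δ`-readout on `[0, τw]`) and
for `t ≥ τw` the smoothing brick on `[t − τw, t]` (LATE inputs `Dτ, Ψτ`, half-smallness, `δ`-readout for `t ∈ [τw, T]`).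
[cite: RobinsonRodrigoSadowskiCUP2016, Thm 9.1 and Thm 1.20] [cite: DashtiRobinson2008, Thm 1, Thm 2]
[cite: ConstantinFoias1988, Ch. 10 (proof of Thm 10.6)] [cite: Tao2011, Thm. 5.4 (ii)+(iv)] -/
theorem freeRun_near_of_strainHybrid (hT : 0 < T) (hτw : 0 < τw) (hτwT : τw ≤ T)
    (hw : IsClassicalNSSolutionOn (Icc 0 T) 1 r w ϖ)
    (hwS : HasBoundedSobolevNormsOn (Icc 0 T) w)
    (hwt : HasBoundedSobolevNormsOn (Icc 0 T) (FluidPDE.timeDerivWithin (Icc 0 T) w))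
    (hϖS : ∀ n : ℕ, ∃ C' : ℝ≥0, ∀ t ∈ Icc 0 T, ∫⁻ x, ‖iteratedFDeriv ℝ n (ϖ t) x‖ₑ ^ 2 ≤ C')
    (hrL2 : ∀ t ∈ Icc 0 T, ∫⁻ x, ‖r t x‖ₑ ^ 2 < ⊤)
    (hrD : ∀ t ∈ Icc 0 T, ∫⁻ x, ‖fderiv ℝ (r t) x‖ₑ ^ 2 < ⊤)
    (hκ : 0 < κ) (hμ : 0 < μ)
    (hG : ∀ s ∈ Icc 0 T, ∀ (x ξ : EuclideanSpace ℝ (Fin 3)), -⟪fderiv ℝ (w s) x ξ, ξ⟫ ≤ G s * ‖ξ‖ ^ 2)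
    (hG0 : ∀ s ∈ Icc 0 T, 0 ≤ G s)
    (hσ₂ : ∀ s ∈ Icc 0 T, ∀ x, ‖iteratedFDeriv ℝ 2 (w s) x‖ ≤ σ₂ s)
    (hσ₃ : ∀ s ∈ Icc 0 T, ∀ x, ‖iteratedFDeriv ℝ 3 (w s) x‖ ≤ σ₃ s)
    (hRr0 : ∀ s ∈ Icc 0 T, 0 ≤ Rr s) (hRr : ∀ s ∈ Icc 0 T, ∫ x, ‖r s x‖ ^ 2 ≤ Rr s ^ 2)
    (hLdef : ∀ s ∈ Icc 0 T, (E₀ + ∫ τ in (0 : ℝ)..s, Rr τ) * Real.exp (∫ τ in (0 : ℝ)..s, G τ) ≤ L s)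
    (hH₁ : ∀ s ∈ Icc 0 T, ∫ x, ‖fderiv ℝ (fun y => r s y - (0 : EuclideanSpace ℝ (Fin 3))) x‖ ^ 2 ≤ H₁ s)
    (hψ₁ : ∀ s ∈ Icc 0 T, 2 / 1 * (∫ x, ‖r s x - (0 : EuclideanSpace ℝ (Fin 3))‖ ^ 2) +
      3 * σ₂ s / κ * L s ^ 2 ≤ ψ₁ s)
    (hψ₂ : ∀ s ∈ Icc 0 T, 27 * σ₂ s / κ * X₁ s + 9 * σ₃ s / κ ^ 2 * L s ^ 2 + 6 / 1 * H₁ s ≤ ψ₂ s)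
    (hGc : ContinuousOn G (Icc 0 T)) (hσ₂c : ContinuousOn σ₂ (Icc 0 T)) (hσ₃c : ContinuousOn σ₃ (Icc 0 T))
    (hRrc : ContinuousOn Rr (Icc 0 T)) (hLc : ContinuousOn L (Icc 0 T)) (hX₁c : ContinuousOn X₁ (Icc 0 T))
    (hH₁c : ContinuousOn H₁ (Icc 0 T)) (hψ₁c : ContinuousOn ψ₁ (Icc 0 T)) (hψ₂c : ContinuousOn ψ₂ (Icc 0 T))
    (hU : ContDiff ℝ ∞ U) (hUc : HasCompactSupport U)
    (hE₀ : 0 ≤ E₀) (hE0 : ∫ x, ‖U x - w 0 x‖ ^ 2 ≤ E₀ ^ 2)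
    (hD₁ : ∫ x, frobeniusNormSq (fderiv ℝ (fun y => U y - w 0 y) x) ≤ D₁)
    (hD₂ : (∑ i, ∫ x, frobeniusNormSq (fderiv ℝ (fun y => fderiv ℝ (fun z => U z - w 0 z) y
      (EuclideanSpace.basisFun (Fin 3) ℝ i)) x)) ≤ D₂)
    (hΨ₁ : ∫ s in (0 : ℝ)..T, ψ₁ s ≤ Ψ₁) (hΨ₂ : ∫ s in (0 : ℝ)..τw, ψ₂ s ≤ Ψ₂)
    (hhalf₁ : 2 * (agmonConst ^ 4 / (2 * (1 : ℝ) ^ 3) *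
        Real.exp (2 * ∫ s in (0 : ℝ)..T, (4 * G s + 3 * κ * σ₂ s))) * (D₁ + Ψ₁) ^ 2 * (T - 0) ≤ 1 / 2)
    (hX₁ : ∀ s ∈ Icc 0 T,
      Real.sqrt 2 * (Real.exp (∫ τ in (0 : ℝ)..s, (4 * G τ + 3 * κ * σ₂ τ)) * (D₁ + Ψ₁)) ≤ X₁ s)
    (hhalf₂ : agmonConst ^ 2 * μ / 1 *
        Real.exp (∫ s in (0 : ℝ)..τw, (6 * G s + 9 * κ * σ₂ s + 3 * κ ^ 2 * σ₃ s +
          3 * agmonConst ^ 2 * X₁ s / (1 * μ) + 27 * agmonConst ^ 4 * X₁ s ^ 2 / (16 * (1 : ℝ) ^ 3))) *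
      (D₂ + Ψ₂) * (τw - 0) ≤ 1 / 2)
    (hδ₁ : ∀ t ∈ Icc 0 τw, agmonConst * (3 * X₁ t *
      (2 * (Real.exp (∫ s in (0 : ℝ)..t, (6 * G s + 9 * κ * σ₂ s + 3 * κ ^ 2 * σ₃ s +
          3 * agmonConst ^ 2 * X₁ s / (1 * μ) + 27 * agmonConst ^ 4 * X₁ s ^ 2 / (16 * (1 : ℝ) ^ 3))) *
        (D₂ + Ψ₂)))) ^ (1 / 4 : ℝ) ≤ δ)
    (hDτ : ∀ t ∈ Icc τw T, X₁ (t - τw) + ∫ s in (t - τw)..t, ((4 * G s + 3 * κ * σ₂ s) * X₁ s +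
        4 * agmonConst ^ 4 * X₁ s ^ 3 / (1 : ℝ) ^ 3 + 4 / 1 * Rr s ^ 2 + 3 * σ₂ s / κ * L s ^ 2) ≤ Dτ t)
    (hΨτ : ∀ t ∈ Icc τw T, ∫ s in (t - τw)..t, ψ₂ s ≤ Ψτ t)
    (hhalf₃ : ∀ t ∈ Icc τw T, agmonConst ^ 2 * μ / 1 *
        Real.exp (∫ s in (t - τw)..t, (6 * G s + 9 * κ * σ₂ s + 3 * κ ^ 2 * σ₃ s +
          3 * agmonConst ^ 2 * X₁ s / (1 * μ) + 27 * agmonConst ^ 4 * X₁ s ^ 2 / (16 * (1 : ℝ) ^ 3))) *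
      (2 * Dτ t / (1 * τw) + Ψτ t) * τw ≤ 1 / 2)
    (hδ₂ : ∀ t ∈ Icc τw T, agmonConst * (3 * X₁ t *
      (2 * Real.exp (∫ s in (t - τw)..t, (6 * G s + 9 * κ * σ₂ s + 3 * κ ^ 2 * σ₃ s +
          3 * agmonConst ^ 2 * X₁ s / (1 * μ) + 27 * agmonConst ^ 4 * X₁ s ^ 2 / (16 * (1 : ℝ) ^ 3))) *
        (2 * Dτ t / (1 * τw) + Ψτ t))) ^ (1 / 4 : ℝ) ≤ δ)
    {s : ℝ} (hs0 : 0 < s) (hsT : s ≤ T)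
    {v : ℝ → EuclideanSpace ℝ (Fin 3) → EuclideanSpace ℝ (Fin 3)} {q₀ : ℝ → EuclideanSpace ℝ (Fin 3) → ℝ}
    (hv : IsClassicalNSSolutionOn (Icc 0 s) 1 0 v q₀) (hv0 : v 0 = U)
    (hEv : ∃ C : ℝ≥0∞, C < ⊤ ∧ ∀ t ∈ Icc 0 s, ∫⁻ x, ‖v t x‖ₑ ^ 2 ≤ C) :
    ∀ t ∈ Icc 0 s, ∀ x, ‖v t x - w t x‖ ≤ δ := by
  have hsub : Icc 0 s ⊆ Icc 0 T := Icc_subset_Icc le_rfl hsT; have hUs : UniqueDiffOn ℝ (Icc 0 s) := uniqueDiffOn_Icc hs0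
  have hdec : HasRapidSpatialDecay U := hasRapidSpatialDecay_of_hasCompactSupport hU hUc
  have h₀ : ∀ m : ℕ, ∫⁻ x, ‖iteratedFDeriv ℝ m (v 0) x‖ₑ ^ 2 < ⊤ := fun m => by
    rw [hv0]; exact hdec.lintegral_enorm_iteratedFDeriv_sq_lt_top m
  have hEv_nn : ∃ C : ℝ≥0, ∀ t ∈ Icc 0 s, ∫⁻ x, ‖v t x‖ₑ ^ 2 ≤ C := by
    obtain ⟨C, hC, hb⟩ := hEv
    exact ⟨C.toNNReal, fun t ht => (hb t ht).trans (ENNReal.coe_toNNReal hC.ne).ge⟩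
  have hvSob : HasBoundedSobolevNormsOn (Icc 0 s) v :=
    hv.hasBoundedSobolevNormsOn_of_sobolevDatum_unforced one_pos hs0 hEv_nn h₀
  have hHk : IsHkClassicalSolutionOn (Icc 0 s) v q₀ := by
    refine ⟨hv, fun n => ?_⟩; obtain ⟨C, hC⟩ := hvSob n
    exact ⟨NNReal.sqrt C, fun t ht => eLpNorm_le_sqrt_of_lintegral_sq_le (hC t ht)⟩
  obtain ⟨q, hTao⟩ := hHk.exists_isTaoSolutionOn hs0
  have hv' : IsClassicalNSSolutionOn (Icc 0 s) 1 0 v q := hTao.classical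
  have hw' : IsClassicalNSSolutionOn (Icc 0 s) 1 r w ϖ := hw.mono hsub hUs
  have hwS' : HasBoundedSobolevNormsOn (Icc 0 s) w := fun n => (hwS n).imp fun C hC t ht => hC t (hsub ht)
  have hwt' : HasBoundedSobolevNormsOn (Icc 0 s) (FluidPDE.timeDerivWithin (Icc 0 s) w) := by
    intro n; obtain ⟨C, hC⟩ := hwt n; refine ⟨C, fun t ht => ?_⟩
    have heq : FluidPDE.timeDerivWithin (Icc 0 s) w t = FluidPDE.timeDerivWithin (Icc 0 T) w t :=
      funext (hw.smooth_velocity.timeDerivWithin_eq_of_subset hsub hUs ht)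
    rw [heq]; exact hC t (hsub ht)
  have hϖS' : ∀ n : ℕ, ∃ C' : ℝ≥0, ∀ t ∈ Icc 0 s, ∫⁻ x, ‖iteratedFDeriv ℝ n (ϖ t) x‖ₑ ^ 2 ≤ C' :=
    fun n => (hϖS n).imp fun C hC t ht => hC t (hsub ht)
  -- ### the `L²` stage on `[0, s]`: `‖v − w‖₂ ≤ L`
  have hzeroL2 : ∀ t ∈ Icc 0 s,
      ∫⁻ x, ‖(0 : ℝ → EuclideanSpace ℝ (Fin 3) → EuclideanSpace ℝ (Fin 3)) t x‖ₑ ^ 2 < ⊤ := by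
    intro t _; simp
  have hl2 := l2_stability_strain_forced (ν := 1) one_pos hs0 hv' hw' hzeroL2 (fun t ht => hrL2 t (hsub ht))
    hTao.sobolev hTao.sobolev_dt hTao.sobolev_p hwS' hwt' hϖS' (hGc.mono hsub) (hRrc.mono hsub)
    (fun t ht => hG0 t (hsub ht)) (fun t ht => hRr0 t (hsub ht))
    (fun t ht x ξ => by rw [real_inner_comm]; exact hG t (hsub ht) x ξ)
    (fun t ht => by
      have h := hRr t (hsub ht)
      refine le_trans (le_of_eq (integral_congr_ae (Eventually.of_forall fun x => ?_))) h
      simp only [Pi.zero_apply, zero_sub, norm_neg])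
  have hL : ∀ t ∈ Icc 0 s, Real.sqrt (∫ x, ‖(v - w) t x‖ ^ 2) ≤ L t := by
    intro t ht
    have h1 := hl2 t ht
    rw [hv0] at h1
    have hE : Real.sqrt (∫ x, ‖U x - w 0 x‖ ^ 2) ≤ E₀ := by
      rw [← Real.sqrt_sq hE₀]; exact Real.sqrt_le_sqrt hE0
    have hexp : 0 ≤ Real.exp (∫ τ in (0 : ℝ)..t, G τ) := Real.exp_nonneg _
    have hint : 0 ≤ ∫ τ in (0 : ℝ)..t, Rr τ :=
      intervalIntegral.integral_nonneg ht.1 fun τ hτ => hRr0 τ (hsub ⟨hτ.1, hτ.2.trans ht.2⟩)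
    have h2 : (Real.sqrt (∫ x, ‖U x - w 0 x‖ ^ 2) + ∫ τ in (0 : ℝ)..t, Rr τ) * Real.exp (∫ τ in (0 : ℝ)..t, G τ) ≤
        (E₀ + ∫ τ in (0 : ℝ)..t, Rr τ) * Real.exp (∫ τ in (0 : ℝ)..t, G τ) :=
      mul_le_mul_of_nonneg_right (by linarith) hexp
    have h3 : (fun x => ‖(v - w) t x‖ ^ 2) = fun x => ‖v t x - w t x‖ ^ 2 := by
      funext x; rfl
    rw [h3]; exact h1.trans (h2.trans (hLdef t (hsub ht)))
  have hgD' : ∀ t ∈ Icc 0 s,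
      ∫⁻ x, ‖fderiv ℝ ((0 : ℝ → EuclideanSpace ℝ (Fin 3) → EuclideanSpace ℝ (Fin 3)) t) x‖ₑ ^ 2 < ⊤ := by
    intro t _
    have hz : ∀ x : EuclideanSpace ℝ (Fin 3),
        ‖fderiv ℝ ((0 : ℝ → EuclideanSpace ℝ (Fin 3) → EuclideanSpace ℝ (Fin 3)) t) x‖ₑ ^ 2 = 0 := by
      intro x
      have h0 : fderiv ℝ ((0 : ℝ → EuclideanSpace ℝ (Fin 3) → EuclideanSpace ℝ (Fin 3)) t) x = 0 := by
        change fderiv ℝ (fun _ : EuclideanSpace ℝ (Fin 3) => (0 : EuclideanSpace ℝ (Fin 3))) x = 0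
        exact fderiv_const_apply 0
      rw [h0, enorm_eq_nnnorm, nnnorm_zero, ENNReal.coe_zero, zero_pow two_ne_zero]
    simp_rw [hz, lintegral_zero]; exact ENNReal.zero_lt_top
  have hσ₂0 : ∀ t ∈ Icc 0 T, 0 ≤ σ₂ t := fun t ht => (norm_nonneg _).trans (hσ₂ t ht 0)
  have hσ₃0 : ∀ t ∈ Icc 0 T, 0 ≤ σ₃ t := fun t ht => (norm_nonneg _).trans (hσ₃ t ht 0)
  have hH₁0 : ∀ t ∈ Icc 0 T, 0 ≤ H₁ t := fun t ht => (integral_nonneg fun x => sq_nonneg _).trans (hH₁ t ht)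
  have hψ₁0 : ∀ t ∈ Icc 0 T, 0 ≤ ψ₁ t := fun t ht => by
    refine le_trans ?_ (hψ₁ t ht)
    have : 0 ≤ ∫ x, ‖r t x - (0 : EuclideanSpace ℝ (Fin 3))‖ ^ 2 := integral_nonneg fun x => sq_nonneg _
    have := hσ₂0 t ht
    positivity
  have hη₁0 : 0 ≤ D₁ + Ψ₁ := by
    have h1 : 0 ≤ D₁ := (integral_nonneg fun x => frobeniusNormSq_nonneg _).trans hD₁
    have h2 : 0 ≤ Ψ₁ := (intervalIntegral.integral_nonneg hT.le hψ₁0).trans hΨ₁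
    linarith
  have hX₁0 : ∀ t ∈ Icc 0 T, 0 ≤ X₁ t := fun t ht => le_trans (by positivity) (hX₁ t ht)
  have hψ₂0 : ∀ t ∈ Icc 0 T, 0 ≤ ψ₂ t := fun t ht => by
    refine le_trans ?_ (hψ₂ t ht)
    have := hσ₂0 t ht; have := hσ₃0 t ht; have := hX₁0 t ht; have := hH₁0 t ht
    positivity
  have hΨ₁' : ∫ τ in (0 : ℝ)..s, ψ₁ τ ≤ Ψ₁ := by
    refine le_trans ?_ hΨ₁
    exact intervalIntegral.integral_mono_interval le_rfl hs0.le hsT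
      ((ae_restrict_iff' measurableSet_Ioc).2 (Eventually.of_forall fun τ hτ => hψ₁0 τ (Ioc_subset_Icc_self hτ)))
      (hψ₁c.intervalIntegrable_of_Icc hT.le)
  have hl₁c : ContinuousOn (fun τ => 4 * G τ + 3 * κ * σ₂ τ) (Icc 0 T) :=
    (continuousOn_const.mul hGc).add (continuousOn_const.mul hσ₂c)
  have hl₁0 : ∀ τ ∈ Icc 0 T, 0 ≤ 4 * G τ + 3 * κ * σ₂ τ := fun τ hτ => by
    have := hG0 τ hτ; have := hσ₂0 τ hτ; positivity
  have hl₂c : ContinuousOn (fun τ => 6 * G τ + 9 * κ * σ₂ τ + 3 * κ ^ 2 * σ₃ τ +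
      3 * agmonConst ^ 2 * X₁ τ / (1 * μ) + 27 * agmonConst ^ 4 * X₁ τ ^ 2 / (16 * (1 : ℝ) ^ 3)) (Icc 0 T) := by
    refine ((((continuousOn_const.mul hGc).add (continuousOn_const.mul hσ₂c)).add
      (continuousOn_const.mul hσ₃c)).add ((continuousOn_const.mul hX₁c).div_const _)).add
      ((continuousOn_const.mul (hX₁c.pow 2)).div_const _)
  have hl₂0 : ∀ τ ∈ Icc 0 T, 0 ≤ 6 * G τ + 9 * κ * σ₂ τ + 3 * κ ^ 2 * σ₃ τ +
      3 * agmonConst ^ 2 * X₁ τ / (1 * μ) + 27 * agmonConst ^ 4 * X₁ τ ^ 2 / (16 * (1 : ℝ) ^ 3) := fun τ hτ => by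
    have := hG0 τ hτ; have := hσ₂0 τ hτ; have := hσ₃0 τ hτ; have := hX₁0 τ hτ
    have := agmonConst_nonneg
    positivity
  have hmono₁ : ∫ τ in (0 : ℝ)..s, (4 * G τ + 3 * κ * σ₂ τ) ≤ ∫ τ in (0 : ℝ)..T, (4 * G τ + 3 * κ * σ₂ τ) :=
    intervalIntegral.integral_mono_interval le_rfl hs0.le hsT
      ((ae_restrict_iff' measurableSet_Ioc).2 (Eventually.of_forall fun τ hτ => hl₁0 τ (Ioc_subset_Icc_self hτ)))
      (hl₁c.intervalIntegrable_of_Icc hT.le)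
  have hη₂0 : 0 ≤ D₂ + Ψ₂ := by
    have h1 : 0 ≤ D₂ := (Finset.sum_nonneg fun i _ => integral_nonneg fun x => frobeniusNormSq_nonneg _).trans hD₂
    have h2 : 0 ≤ Ψ₂ := (intervalIntegral.integral_nonneg hτw.le fun τ hτ => hψ₂0 τ ⟨hτ.1, hτ.2.trans hτwT⟩).trans hΨ₂
    linarith
  have hhalf₁' : 2 * (agmonConst ^ 4 / (2 * (1 : ℝ) ^ 3) *
      Real.exp (2 * ∫ τ in (0 : ℝ)..s, (4 * G τ + 3 * κ * σ₂ τ))) * (D₁ + Ψ₁) ^ 2 * (s - 0) ≤ 1 / 2 := by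
    refine le_trans ?_ hhalf₁
    have hA := agmonConst_nonneg
    have he : Real.exp (2 * ∫ τ in (0 : ℝ)..s, (4 * G τ + 3 * κ * σ₂ τ)) ≤
        Real.exp (2 * ∫ τ in (0 : ℝ)..T, (4 * G τ + 3 * κ * σ₂ τ)) := Real.exp_le_exp.2 (by linarith)
    have hsq : 0 ≤ (D₁ + Ψ₁) ^ 2 := sq_nonneg _
    calc 2 * (agmonConst ^ 4 / (2 * (1 : ℝ) ^ 3) *
          Real.exp (2 * ∫ τ in (0 : ℝ)..s, (4 * G τ + 3 * κ * σ₂ τ))) * (D₁ + Ψ₁) ^ 2 * (s - 0)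
        ≤ 2 * (agmonConst ^ 4 / (2 * (1 : ℝ) ^ 3) *
          Real.exp (2 * ∫ τ in (0 : ℝ)..T, (4 * G τ + 3 * κ * σ₂ τ))) * (D₁ + Ψ₁) ^ 2 * (s - 0) := by
          gcongr
      _ ≤ 2 * (agmonConst ^ 4 / (2 * (1 : ℝ) ^ 3) *
          Real.exp (2 * ∫ τ in (0 : ℝ)..T, (4 * G τ + 3 * κ * σ₂ τ))) * (D₁ + Ψ₁) ^ 2 * (T - 0) := by
          apply mul_le_mul_of_nonneg_left (by linarith) (by positivity)
  have hvw0 : (v - w) 0 = fun y => U y - w 0 y := by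
    funext y; simp [hv0]
  have hD₁' : ∫ x, frobeniusNormSq (fderiv ℝ ((v - w) 0) x) ≤ D₁ := by rw [hvw0]; exact hD₁
  have hD₂' : (∑ i, ∫ x, frobeniusNormSq (fderiv ℝ (fun y => fderiv ℝ ((v - w) 0) y
      (EuclideanSpace.basisFun (Fin 3) ℝ i)) x)) ≤ D₂ := by rw [hvw0]; exact hD₂
  -- ### the `H¹` letter on `[0, s]`: `∫|∇(v − w)(τ)|²_F ≤ X₁(τ)`
  obtain ⟨c₁, hc₁⟩ : ∃ c₁ : ℝ, c₁ = 2 * (agmonConst ^ 4 / (2 * (1 : ℝ) ^ 3) *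
      Real.exp (2 * ∫ τ in (0 : ℝ)..s, (4 * G τ + 3 * κ * σ₂ τ))) := ⟨_, rfl⟩
  have hA0 : 0 ≤ agmonConst := agmonConst_nonneg
  have hc₁0 : 0 ≤ c₁ := by rw [hc₁]; positivity
  rw [← hc₁] at hhalf₁'
  have hsmall₁ : c₁ * (D₁ + Ψ₁) ^ 2 * (s - 0) < 1 := hhalf₁'.trans_lt (by norm_num)
  have hXle : ∀ τ ∈ Icc 0 s, ∫ x, frobeniusNormSq (fderiv ℝ ((v - w) τ) x) ≤ X₁ τ := by
    intro τ hτ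
    have h1 := classicalNS_robustness_strain_window_of_le_R3 (ν := (1 : ℝ)) one_pos hs0 hv' hw' hwS' hwt' hϖS'
      hTao.sobolev hTao.sobolev_dt hTao.sobolev_p hκ (fun τ hτ => hG τ (hsub hτ)) (fun τ hτ => hσ₂ τ (hsub hτ)) hL
      (fun τ hτ => hψ₁ τ (hsub hτ)) (hGc.mono hsub) (hσ₂c.mono hsub) (hψ₁c.mono hsub) hD₁' hΨ₁'
      (by rw [← hc₁]; exact hsmall₁) hτ
    rw [← hc₁] at h1
    refine h1.trans (le_trans ?_ (hX₁ τ (hsub hτ)))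
    have hden : 1 / 2 ≤ 1 - c₁ * (D₁ + Ψ₁) ^ 2 * (τ - 0) := by
      have : c₁ * (D₁ + Ψ₁) ^ 2 * (τ - 0) ≤ c₁ * (D₁ + Ψ₁) ^ 2 * (s - 0) :=
        mul_le_mul_of_nonneg_left (sub_le_sub_right hτ.2 _) (by positivity)
      linarith
    have hsq : Real.sqrt (1 / 2) ≤ Real.sqrt (1 - c₁ * (D₁ + Ψ₁) ^ 2 * (τ - 0)) := Real.sqrt_le_sqrt hden
    have hhalf : 0 < Real.sqrt (1 / 2) := Real.sqrt_pos.2 (by norm_num)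
    have hnum : 0 ≤ Real.exp (∫ r in (0 : ℝ)..τ, (4 * G r + 3 * κ * σ₂ r)) * (D₁ + Ψ₁) := by positivity
    calc Real.exp (∫ r in (0 : ℝ)..τ, (4 * G r + 3 * κ * σ₂ r)) * (D₁ + Ψ₁) /
          Real.sqrt (1 - c₁ * (D₁ + Ψ₁) ^ 2 * (τ - 0))
        ≤ Real.exp (∫ r in (0 : ℝ)..τ, (4 * G r + 3 * κ * σ₂ r)) * (D₁ + Ψ₁) / Real.sqrt (1 / 2) :=
          div_le_div_of_nonneg_left hnum hhalf hsq
      _ = Real.sqrt 2 * (Real.exp (∫ r in (0 : ℝ)..τ, (4 * G r + 3 * κ * σ₂ r)) * (D₁ + Ψ₁)) := by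
          have h2 : Real.sqrt (1 / 2) = 1 / Real.sqrt 2 := by
            rw [Real.sqrt_div' _ (by norm_num : (0 : ℝ) ≤ 2), Real.sqrt_one]
          rw [h2]
          field_simp
  -- ### the `L²` majorant of the force difference `r − 0`
  have hH₀ : ∀ τ ∈ Icc 0 s, ∫ x, ‖r τ x - (0 : ℝ → EuclideanSpace ℝ (Fin 3) → EuclideanSpace ℝ (Fin 3)) τ x‖ ^ 2 ≤
      Rr τ ^ 2 := fun τ hτ => by
    refine le_trans (le_of_eq (integral_congr_ae (Eventually.of_forall fun x => ?_))) (hRr τ (hsub hτ))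
    simp only [Pi.zero_apply, sub_zero]
  have hRr2c : ContinuousOn (fun τ => Rr τ ^ 2) (Icc 0 T) := hRrc.pow 2
  intro t ht x
  by_cases hts : t ≤ τw
  · -- ### EARLY readout: the `H²`-datum door on `[0, s']`, `s' = min s τw`
    obtain ⟨s', hs'⟩ : ∃ s' : ℝ, s' = min s τw := ⟨_, rfl⟩
    have hs's : s' ≤ s := by rw [hs']; exact min_le_left _ _
    have hs'w : s' ≤ τw := by rw [hs']; exact min_le_right _ _
    have hs'0 : 0 < s' := by rw [hs']; exact lt_min hs0 hτw
    have hts' : t ∈ Icc 0 s' := ⟨ht.1, by rw [hs']; exact le_min ht.2 hts⟩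
    have hsub' : Icc 0 s' ⊆ Icc 0 s := Icc_subset_Icc le_rfl hs's
    have hsubT : Icc 0 s' ⊆ Icc 0 T := hsub'.trans hsub
    have hUs' : UniqueDiffOn ℝ (Icc 0 s') := uniqueDiffOn_Icc hs'0
    -- restriction of the two runs to `[0, s']`
    have hWeq : ∀ {z : ℝ → EuclideanSpace ℝ (Fin 3) → EuclideanSpace ℝ (Fin 3)},
        IsSmoothSpaceTimeOn (Icc 0 s) z → ∀ τ ∈ Icc 0 s',
          FluidPDE.timeDerivWithin (Icc 0 s') z τ = FluidPDE.timeDerivWithin (Icc 0 s) z τ := fun hz τ hτ =>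
      funext fun y => hz.timeDerivWithin_eq_of_subset hsub' hUs' hτ y
    have hwt'' : HasBoundedSobolevNormsOn (Icc 0 s') (FluidPDE.timeDerivWithin (Icc 0 s') w) := by
      intro n
      obtain ⟨C, hC⟩ := hwt' n
      exact ⟨C, fun τ hτ => by rw [hWeq hw'.smooth_velocity τ hτ]; exact hC τ (hsub' hτ)⟩
    have hvt'' : HasBoundedSobolevNormsOn (Icc 0 s') (FluidPDE.timeDerivWithin (Icc 0 s') v) := by
      intro n
      obtain ⟨C, hC⟩ := hTao.sobolev_dt n
      exact ⟨C, fun τ hτ => by rw [hWeq hv'.smooth_velocity τ hτ]; exact hC τ (hsub' hτ)⟩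
    -- monotone consequences on `[0, s']`
    have hΨ₁'' : ∫ τ in (0 : ℝ)..s', ψ₁ τ ≤ Ψ₁ := by
      refine le_trans ?_ hΨ₁
      exact intervalIntegral.integral_mono_interval le_rfl hs'0.le (hs's.trans hsT)
        ((ae_restrict_iff' measurableSet_Ioc).2 (Eventually.of_forall fun τ hτ => hψ₁0 τ (Ioc_subset_Icc_self hτ)))
        (hψ₁c.intervalIntegrable_of_Icc hT.le)
    have hΨ₂'' : ∫ τ in (0 : ℝ)..s', ψ₂ τ ≤ Ψ₂ := by
      refine le_trans ?_ hΨ₂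
      exact intervalIntegral.integral_mono_interval le_rfl hs'0.le hs'w
        ((ae_restrict_iff' measurableSet_Ioc).2 (Eventually.of_forall fun τ hτ =>
          hψ₂0 τ ⟨hτ.1.le, hτ.2.trans hτwT⟩))
        ((hψ₂c.mono (Icc_subset_Icc le_rfl hτwT)).intervalIntegrable_of_Icc hτw.le)
    have hhalf₁'' : 2 * (agmonConst ^ 4 / (2 * (1 : ℝ) ^ 3) *
        Real.exp (2 * ∫ τ in (0 : ℝ)..s', (4 * G τ + 3 * κ * σ₂ τ))) * (D₁ + Ψ₁) ^ 2 * (s' - 0) ≤ 1 / 2 := by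
      refine le_trans ?_ hhalf₁
      have hmono : ∫ τ in (0 : ℝ)..s', (4 * G τ + 3 * κ * σ₂ τ) ≤ ∫ τ in (0 : ℝ)..T, (4 * G τ + 3 * κ * σ₂ τ) :=
        intervalIntegral.integral_mono_interval le_rfl hs'0.le (hs's.trans hsT)
          ((ae_restrict_iff' measurableSet_Ioc).2 (Eventually.of_forall fun τ hτ => hl₁0 τ (Ioc_subset_Icc_self hτ)))
          (hl₁c.intervalIntegrable_of_Icc hT.le)
      have he : Real.exp (2 * ∫ τ in (0 : ℝ)..s', (4 * G τ + 3 * κ * σ₂ τ)) ≤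
          Real.exp (2 * ∫ τ in (0 : ℝ)..T, (4 * G τ + 3 * κ * σ₂ τ)) := Real.exp_le_exp.2 (by linarith)
      calc 2 * (agmonConst ^ 4 / (2 * (1 : ℝ) ^ 3) *
            Real.exp (2 * ∫ τ in (0 : ℝ)..s', (4 * G τ + 3 * κ * σ₂ τ))) * (D₁ + Ψ₁) ^ 2 * (s' - 0)
          ≤ 2 * (agmonConst ^ 4 / (2 * (1 : ℝ) ^ 3) *
            Real.exp (2 * ∫ τ in (0 : ℝ)..T, (4 * G τ + 3 * κ * σ₂ τ))) * (D₁ + Ψ₁) ^ 2 * (s' - 0) := by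
            gcongr
        _ ≤ 2 * (agmonConst ^ 4 / (2 * (1 : ℝ) ^ 3) *
            Real.exp (2 * ∫ τ in (0 : ℝ)..T, (4 * G τ + 3 * κ * σ₂ τ))) * (D₁ + Ψ₁) ^ 2 * (T - 0) := by
            apply mul_le_mul_of_nonneg_left (by linarith [hs's.trans hsT]) (by positivity)
    have hmonoW : ∫ τ in (0 : ℝ)..s', (6 * G τ + 9 * κ * σ₂ τ + 3 * κ ^ 2 * σ₃ τ +
        3 * agmonConst ^ 2 * X₁ τ / (1 * μ) + 27 * agmonConst ^ 4 * X₁ τ ^ 2 / (16 * (1 : ℝ) ^ 3)) ≤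
        ∫ τ in (0 : ℝ)..τw, (6 * G τ + 9 * κ * σ₂ τ + 3 * κ ^ 2 * σ₃ τ +
        3 * agmonConst ^ 2 * X₁ τ / (1 * μ) + 27 * agmonConst ^ 4 * X₁ τ ^ 2 / (16 * (1 : ℝ) ^ 3)) :=
      intervalIntegral.integral_mono_interval le_rfl hs'0.le hs'w
        ((ae_restrict_iff' measurableSet_Ioc).2 (Eventually.of_forall fun τ hτ =>
          hl₂0 τ ⟨hτ.1.le, hτ.2.trans hτwT⟩))
        ((hl₂c.mono (Icc_subset_Icc le_rfl hτwT)).intervalIntegrable_of_Icc hτw.le)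
    have hhalf₂'' : agmonConst ^ 2 * μ / 1 *
        Real.exp (∫ τ in (0 : ℝ)..s', (6 * G τ + 9 * κ * σ₂ τ + 3 * κ ^ 2 * σ₃ τ +
          3 * agmonConst ^ 2 * X₁ τ / (1 * μ) + 27 * agmonConst ^ 4 * X₁ τ ^ 2 / (16 * (1 : ℝ) ^ 3))) *
        (D₂ + Ψ₂) * (s' - 0) ≤ 1 / 2 := by
      refine le_trans ?_ hhalf₂
      have he := Real.exp_le_exp.2 hmonoW
      have hμ0 : 0 ≤ μ := hμ.le
      calc agmonConst ^ 2 * μ / 1 *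
            Real.exp (∫ τ in (0 : ℝ)..s', (6 * G τ + 9 * κ * σ₂ τ + 3 * κ ^ 2 * σ₃ τ +
              3 * agmonConst ^ 2 * X₁ τ / (1 * μ) + 27 * agmonConst ^ 4 * X₁ τ ^ 2 / (16 * (1 : ℝ) ^ 3))) *
            (D₂ + Ψ₂) * (s' - 0)
          ≤ agmonConst ^ 2 * μ / 1 *
            Real.exp (∫ τ in (0 : ℝ)..τw, (6 * G τ + 9 * κ * σ₂ τ + 3 * κ ^ 2 * σ₃ τ +
              3 * agmonConst ^ 2 * X₁ τ / (1 * μ) + 27 * agmonConst ^ 4 * X₁ τ ^ 2 / (16 * (1 : ℝ) ^ 3))) *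
            (D₂ + Ψ₂) * (s' - 0) := by
            gcongr
        _ ≤ _ := by
            apply mul_le_mul_of_nonneg_left (by linarith) (by positivity)
    have hmain := classicalNS_norm_sub_le_strain_window_half_R3 (ν := (1 : ℝ)) one_pos hs'0 (hv'.mono hsub' hUs')
      (hw'.mono hsub' hUs') (hwS'.mono hsub') hwt'' (fun n => (hϖS' n).imp fun C hC τ hτ => hC τ (hsub' hτ))
      (hTao.sobolev.mono hsub') hvt'' (fun n => (hTao.sobolev_p n).imp fun C hC τ hτ => hC τ (hsub' hτ))
      (fun τ hτ => hrD τ (hsubT hτ)) (fun τ hτ => hgD' τ (hsub' hτ)) hκ hμ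
      (fun τ hτ => hG τ (hsubT hτ)) (fun τ hτ => hσ₂ τ (hsubT hτ)) (fun τ hτ => hσ₃ τ (hsubT hτ))
      (fun τ hτ => hL τ (hsub' hτ)) (fun τ hτ => hH₁ τ (hsubT hτ)) (fun τ hτ => hψ₁ τ (hsubT hτ))
      (fun τ hτ => hψ₂ τ (hsubT hτ))
      (hGc.mono hsubT) (hσ₂c.mono hsubT) (hσ₃c.mono hsubT) (hLc.mono hsubT) (hX₁c.mono hsubT) (hH₁c.mono hsubT)
      (hψ₁c.mono hsubT) (hψ₂c.mono hsubT) hD₁' hΨ₁'' hD₂' hΨ₂'' hhalf₁'' (fun τ hτ => hX₁ τ (hsubT hτ)) hhalf₂''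
      hts' x
    exact hmain.trans (hδ₁ t ⟨ht.1, hts⟩)
  · -- ### LATE readout: smoothing on the sliding window `[t − τw, t] ⊆ [0, s]`
    have htw : τw < t := lt_of_not_ge hts
    have htT : t ∈ Icc τw T := ⟨htw.le, ht.2.trans hsT⟩
    have h0 : 0 ≤ t - τw := sub_nonneg.2 htw.le
    have h01 : t - τw < t := sub_lt_self t hτw
    have ewin : t - (t - τw) = τw := sub_sub_cancel t τw
    have hmid : t ∈ Icc ((t - τw + t) / 2) t := ⟨by linarith only [hτw.le], le_rfl⟩
    have hmain := classicalNS_norm_sub_le_H2_smoothing_subwindow_half_R3 (ν := (1 : ℝ)) one_pos h0 h01 ht.2 hv'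
      hw' hwS' hwt' hϖS' hTao.sobolev hTao.sobolev_dt hTao.sobolev_p hκ hμ
      (fun τ hτ => hG τ (hsub hτ)) (fun τ hτ => hσ₂ τ (hsub hτ)) (fun τ hτ => hσ₃ τ (hsub hτ)) hL hXle hH₀
      (fun τ hτ => hH₁ τ (hsub hτ)) (fun τ hτ => hψ₂ τ (hsub hτ))
      (hGc.mono hsub) (hσ₂c.mono hsub) (hσ₃c.mono hsub) (hLc.mono hsub) (hX₁c.mono hsub) (hRr2c.mono hsub)
      (hH₁c.mono hsub) (hψ₂c.mono hsub) (D := Dτ t) (Ψ₂ := Ψτ t) (hDτ t htT) (hΨτ t htT)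
      (by rw [ewin]; exact hhalf₃ t htT) hmid x
    rw [ewin] at hmain
    exact hmain.trans (hδ₂ t htT)

end Main

end Summit.NavierStokesRegularity.FluidComputer.PalasekTowerClayBridge.StrainShadowHybrid

end
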